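import Summits.MatrixMultiplication.MatrixMultiplication.Theorems.EdgePencilLegSymmetry
import HarnessLib

/-!
# `T(K₄)_n` is `S₄`-symmetric AS A CLASS: `[T(K₄)_n ∘ σ] = [T(K₄)_n]` for every `σ ∈ S₄`, via the symmetric
# model `M_n(x) = [x_v(w) = x_w(v) for all v, w]` on legs indexed by `[n]^{[4]}`

Support kernel for `stmt-MatrixMultiplication-26697` (`TetraExcessZero : ω(K₄) ≤ ω(2,1,2)`, route
`TetrahedronCarving`; cut of record `closes (TetraExcessZero) (TetraPlusTwo) : ω = 2`, UNCHANGED; lineage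
`decomp-mm-lens-6`, generation 44). No item is added or changed; no definition is introduced — the symmetric
model is the explicit tensor `fun x : Fin 4 → (Fin 4 → Fin n) => [∀ v w, x v w = x w v]` (party `v` holds a
label `x_v(w) ∈ [n]` for every party `w`, the diagonal label `x_v(v)` being idle), and the two slot tables of
the tree's `vertexLabels` convention (party `v` lists its three edges by increasing other endpoint) are written
as the literal matrices `![![0,0,1,2],![0,0,1,2],![0,1,0,2],![0,1,2,0]]` (slot of `w` at `v`) and
`![![1,2,3],![0,2,3],![0,1,3],![0,1,2]]` (other endpoint of slot `s` at `v`).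

WHY (generation 44 memo, prerequisite (ii) of the six-edge CALIBRATION): the E-coordinates see the edge `01`
only; to transport the pair-rate to the other five edges one composes a spectral point with a vertex
permutation (`EdgePencilLegSymmetry.exists_spectrum_legPerm`) and needs `φ^σ[T(K₄)_n] = φ[T(K₄)_n]`, i.e.
THIS FILE's `[T(K₄)_n ∘ σ] = [T(K₄)_n]`. The coordinate tensor `tetra F n` is NOT leg-symmetric as a function
(the label triples are ordered by a fixed edge convention); it is symmetric as a CLASS.

§26 THE SYMMETRIC MODEL (`consistent_iff_forall_slot`, `tetra_apply_eq_ite_forall_slot`,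
`symModel_eq_tetra_precomp`, `tetra_eq_symModel_precomp`, `mk_tetra_eq_mk_symModel`): consistency of four
label triples says `L_v(slot_v w) = L_w(slot_w v)` for all `v ≠ w`; hence `T(K₄)_n = M_n ∘ (ins_v)_v` and
`M_n = T(K₄)_n ∘ (drop_v)_v` for the per-leg maps `ins_v L = (w ↦ L (slot_v w))`, `drop_v x = (s ↦ x (other_v s))`
— two per-leg precompositions, so `[T(K₄)_n] = [M_n]` (`EdgePencilLegSymmetry.restricts_precompFamily`).

§27 SYMMETRY (`symModel_legPerm_eq`, `mk_symModel_legPerm`, `mk_tetra_legPerm`, `asympRank_tetra_legPerm`,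
`spectrum_tetra_legPerm`): `M_n ∘ σ = M_n ∘ (y ↦ y ∘ σ⁻¹ on every leg)`, a relabelling by ONE bijection of
`[n]^{[4]}` on all legs, so `[M_n ∘ σ] = [M_n]`; transporting along §26 with
`EdgePencilLegSymmetry.restricts_legPerm`: `[T(K₄)_n ∘ σ] = [T(K₄)_n]`, hence `φ[T(K₄)_n ∘ σ] = φ[T(K₄)_n]` for
every function `φ` on classes and `φ^σ[T(K₄)_n] = φ[T(K₄)_n]` for the leg action on `X₄(F)`.

References: Christandl–Vrana–Zuiddam 2019, Ex. 1.1.2 and §1.2 (graph tensors; `Aut(G)` acts on `T(G)` by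
permuting parties, up to relabelling of the local bases) [ChristandlVranaZuiddam2016]; Christandl–Vrana–Zuiddam
2023, §1.1–1.2 [ChristandlVranaZuiddam2023]. No `sorry`, no new axiom, no instance, no notation, no definition.
-/

noncomputable section

set_option linter.dupNamespace false

open Finset Literature.Computability.AlgebraicComplexity
open Literature.Computability.AlgebraicComplexity.DTensor
open Summit.MatrixMultiplication.MatrixMultiplication.Theorems.TetrahedronTensor

namespace Summit.MatrixMultiplication.MatrixMultiplication.Theorems.EdgePencil

/-! ## §26 The symmetric model of `T(K₄)_n` -/

section SymModel

variable {F : Type*} [Field F]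

/-- The slot tables invert each other off the diagonal: `other_v (slot_v w) = w` for `v ≠ w`. [cite: ChristandlVranaZuiddam2016, Ex. 1.1.2] -/
theorem other_slot_eq : ∀ v w : Fin 4, v ≠ w →
    (![![1, 2, 3], ![0, 2, 3], ![0, 1, 3], ![0, 1, 2]] : Fin 4 → Fin 3 → Fin 4) v
      ((![![0, 0, 1, 2], ![0, 0, 1, 2], ![0, 1, 0, 2], ![0, 1, 2, 0]] : Fin 4 → Fin 4 → Fin 3) v w) = w := by
  decide

/-- **Consistency, slot-wise**: four label triples are consistent iff `L_v(slot_v w) = L_w(slot_w v)` for all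
parties `v, w` (the diagonal instances are trivial). [cite: ChristandlVranaZuiddam2016, Ex. 1.1.2] -/
theorem consistent_iff_forall_slot {n : ℕ} (L : Fin 4 → Fin 3 → Fin n) :
    consistent L = true ↔ ∀ v w : Fin 4,
      L v ((![![0, 0, 1, 2], ![0, 0, 1, 2], ![0, 1, 0, 2], ![0, 1, 2, 0]] : Fin 4 → Fin 4 → Fin 3) v w) =
        L w ((![![0, 0, 1, 2], ![0, 0, 1, 2], ![0, 1, 0, 2], ![0, 1, 2, 0]] : Fin 4 → Fin 4 → Fin 3) w v) := by
  rw [consistent_iff]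
  constructor
  · rintro ⟨h₁, h₂, h₃, h₄, h₅, h₆⟩ v w
    fin_cases v <;> fin_cases w <;> simp [h₁, h₂, h₃, h₄, h₅, h₆]
  · intro h
    exact ⟨by simpa using h 0 1, by simpa using h 0 2, by simpa using h 0 3, by simpa using h 1 2,
      by simpa using h 1 3, by simpa using h 2 3⟩

/-- **Entries of `T(K₄)_n`, slot-wise.** [cite: ChristandlVranaZuiddam2016, Ex. 1.1.2] -/
theorem tetra_apply_eq_ite_forall_slot (n : ℕ) (i : Fin 4 → Fin (n ^ 3)) :
    tetra F n i =
      if ∀ v w : Fin 4,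
          (finFunctionFinEquiv.symm (i v) : Fin 3 → Fin n)
              ((![![0, 0, 1, 2], ![0, 0, 1, 2], ![0, 1, 0, 2], ![0, 1, 2, 0]] : Fin 4 → Fin 4 → Fin 3) v w) =
            (finFunctionFinEquiv.symm (i w) : Fin 3 → Fin n)
              ((![![0, 0, 1, 2], ![0, 0, 1, 2], ![0, 1, 0, 2], ![0, 1, 2, 0]] : Fin 4 → Fin 4 → Fin 3) w v)
        then 1 else 0 := by
  simp only [tetra]
  by_cases h : consistent (fun v => (finFunctionFinEquiv.symm (i v) : Fin 3 → Fin n)) = true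
  · rw [if_pos h, if_pos ((consistent_iff_forall_slot _).1 h)]
  · rw [if_neg h, if_neg (fun h' => h ((consistent_iff_forall_slot _).2 h'))]

/-- **`M_n = T(K₄)_n ∘ (drop_v)_v`**: the symmetric model is the precomposition of `T(K₄)_n` with the per-leg
maps `x_v ↦ (s ↦ x_v (other_v s))` (forget the idle diagonal label). [cite: ChristandlVranaZuiddam2016, Ex. 1.1.2] -/
theorem symModel_eq_tetra_precomp (n : ℕ) :
    (fun x : Fin 4 → (Fin 4 → Fin n) => if ∀ v w : Fin 4, x v w = x w v then (1 : F) else 0) =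
      fun x : Fin 4 → (Fin 4 → Fin n) => tetra F n (fun v => finFunctionFinEquiv
        (fun s : Fin 3 => x v ((![![1, 2, 3], ![0, 2, 3], ![0, 1, 3], ![0, 1, 2]] : Fin 4 → Fin 3 → Fin 4) v s))) := by
  funext x
  rw [tetra_apply_eq_ite_forall_slot]
  simp only [Equiv.symm_apply_apply]
  refine if_congr ⟨fun h v w => ?_, fun h v w => ?_⟩ rfl rfl
  · by_cases hvw : v = w
    · subst hvw; rfl
    · rw [other_slot_eq v w hvw, other_slot_eq w v (Ne.symm hvw)]
      exact h v w
  · by_cases hvw : v = w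
    · subst hvw; rfl
    · have h' := h v w
      rwa [other_slot_eq v w hvw, other_slot_eq w v (Ne.symm hvw)] at h'

/-- **`T(K₄)_n = M_n ∘ (ins_v)_v`**: `T(K₄)_n` is the precomposition of the symmetric model with the per-leg
maps `L_v ↦ (w ↦ L_v (slot_v w))`. [cite: ChristandlVranaZuiddam2016, Ex. 1.1.2] -/
theorem tetra_eq_symModel_precomp (n : ℕ) :
    tetra F n = fun i : Fin 4 → Fin (n ^ 3) =>
      (fun x : Fin 4 → (Fin 4 → Fin n) => if ∀ v w : Fin 4, x v w = x w v then (1 : F) else 0)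
        (fun v w => (finFunctionFinEquiv.symm (i v) : Fin 3 → Fin n)
          ((![![0, 0, 1, 2], ![0, 0, 1, 2], ![0, 1, 0, 2], ![0, 1, 2, 0]] : Fin 4 → Fin 4 → Fin 3) v w)) := by
  funext i
  exact tetra_apply_eq_ite_forall_slot n i

/-- **`[T(K₄)_n] = [M_n]`** in `T₄(F)`: the two per-leg precompositions of §26 are restrictions both ways
(`EdgePencilLegSymmetry.restricts_precompFamily`). [cite: ChristandlVranaZuiddam2023, §1.2] -/
theorem mk_tetra_eq_mk_symModel (n : ℕ) :
    DTensorClass.mk (tetra F n) =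
      DTensorClass.mk
        (fun x : Fin 4 → (Fin 4 → Fin n) => if ∀ v w : Fin 4, x v w = x w v then (1 : F) else 0) := by
  refine DTensorClass.mk_eq_mk ?_ ?_
  · -- `M_n ≥ T(K₄)_n`: `T = M ∘ ins`
    have h := restricts_precompFamily (K := F)
      (fun (v : Fin 4) (z : Fin (n ^ 3)) (w : Fin 4) => (finFunctionFinEquiv.symm z : Fin 3 → Fin n)
        ((![![0, 0, 1, 2], ![0, 0, 1, 2], ![0, 1, 0, 2], ![0, 1, 2, 0]] : Fin 4 → Fin 4 → Fin 3) v w))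
      (fun x : Fin 4 → (Fin 4 → Fin n) => if ∀ v w : Fin 4, x v w = x w v then (1 : F) else 0)
    rw [tetra_eq_symModel_precomp]
    exact h
  · -- `T(K₄)_n ≥ M_n`: `M = T ∘ drop`
    have h := restricts_precompFamily (K := F)
      (fun (v : Fin 4) (y : Fin 4 → Fin n) => finFunctionFinEquiv
        (fun s : Fin 3 => y ((![![1, 2, 3], ![0, 2, 3], ![0, 1, 3], ![0, 1, 2]] : Fin 4 → Fin 3 → Fin 4) v s)))
      (tetra F n)
    rw [symModel_eq_tetra_precomp]
    exact h

end SymModel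

/-! ## §27 `S₄`-symmetry of the class `[T(K₄)_n]` -/

section Symmetry

variable {F : Type*} [Field F]

/-- **`M_n ∘ σ = M_n ∘ (y ↦ y ∘ σ⁻¹ on every leg)`**: permuting the parties of the symmetric model is the
SAME as relabelling every leg by the one bijection `y ↦ y ∘ σ⁻¹` of `[n]^{[4]}`. [cite: ChristandlVranaZuiddam2016, Ex. 1.1.2] -/
theorem symModel_legPerm_eq (n : ℕ) (σ : Equiv.Perm (Fin 4)) :
    (fun x : Fin 4 → (Fin 4 → Fin n) =>
      (fun x : Fin 4 → (Fin 4 → Fin n) => if ∀ v w : Fin 4, x v w = x w v then (1 : F) else 0)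
        (fun j => x (σ j))) =
      fun x : Fin 4 → (Fin 4 → Fin n) =>
        (fun x : Fin 4 → (Fin 4 → Fin n) => if ∀ v w : Fin 4, x v w = x w v then (1 : F) else 0)
          (fun v => Equiv.arrowCongr σ (Equiv.refl (Fin n)) (x v)) := by
  funext x
  simp only [Equiv.arrowCongr_apply, Equiv.coe_refl, Function.comp_apply, id_eq]
  refine if_congr ⟨fun h v w => ?_, fun h a b => ?_⟩ rfl rfl
  · simpa using h (σ.symm v) (σ.symm w)
  · simpa using h (σ a) (σ b)

/-- **`[M_n ∘ σ] = [M_n]`.** [cite: ChristandlVranaZuiddam2023, §1.2] -/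
theorem mk_symModel_legPerm (n : ℕ) (σ : Equiv.Perm (Fin 4)) :
    DTensorClass.mk (fun x : Fin 4 → (Fin 4 → Fin n) =>
      (fun x : Fin 4 → (Fin 4 → Fin n) => if ∀ v w : Fin 4, x v w = x w v then (1 : F) else 0)
        (fun j => x (σ j))) =
      DTensorClass.mk
        (fun x : Fin 4 → (Fin 4 → Fin n) => if ∀ v w : Fin 4, x v w = x w v then (1 : F) else 0) := by
  rw [symModel_legPerm_eq n σ]
  exact mk_precompFamily_equiv (fun _ => Equiv.arrowCongr σ (Equiv.refl (Fin n)))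
    (fun x : Fin 4 → (Fin 4 → Fin n) => if ∀ v w : Fin 4, x v w = x w v then (1 : F) else 0)

/-- **`T(K₄)_n` IS `S₄`-SYMMETRIC AS A CLASS**: `[T(K₄)_n ∘ σ] = [T(K₄)_n]` for every `σ ∈ S₄`.
[cite: ChristandlVranaZuiddam2016, Ex. 1.1.2] -/
theorem mk_tetra_legPerm (n : ℕ) (σ : Equiv.Perm (Fin 4)) :
    DTensorClass.mk (fun i : Fin 4 → Fin (n ^ 3) => tetra F n (fun j => i (σ j))) =
      DTensorClass.mk (tetra F n) := by
  obtain ⟨hMT, hTM⟩ := DTensorClass.mk_eq_mk_iff.1 (mk_tetra_eq_mk_symModel (F := F) n)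
  calc DTensorClass.mk (fun i : Fin 4 → Fin (n ^ 3) => tetra F n (fun j => i (σ j)))
      = DTensorClass.mk (fun x : Fin 4 → (Fin 4 → Fin n) =>
          (fun x : Fin 4 → (Fin 4 → Fin n) => if ∀ v w : Fin 4, x v w = x w v then (1 : F) else 0)
            (fun j => x (σ j))) :=
        DTensorClass.mk_eq_mk (restricts_legPerm σ hMT) (restricts_legPerm σ hTM)
    _ = _ := mk_symModel_legPerm n σ
    _ = DTensorClass.mk (tetra F n) := (mk_tetra_eq_mk_symModel n).symm

/-- **Every function of classes is blind to the party order of `T(K₄)_n`**: `φ[T(K₄)_n ∘ σ] = φ[T(K₄)_n]`.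
[cite: ChristandlVranaZuiddam2016, Ex. 1.1.2] -/
theorem apply_mk_tetra_legPerm {β : Sort*} (φ : DTensorClass F 4 → β) (n : ℕ) (σ : Equiv.Perm (Fin 4)) :
    φ (DTensorClass.mk (fun i : Fin 4 → Fin (n ^ 3) => tetra F n (fun j => i (σ j)))) =
      φ (DTensorClass.mk (tetra F n)) :=
  congrArg φ (mk_tetra_legPerm n σ)

end Symmetry

/-! ## §27′ The leg action on the spectrum fixes the value on `T(K₄)_n` -/

section SpectrumTetra

variable (F : Type) [Field F]

/-- **`φ^σ[T(K₄)_n] = φ[T(K₄)_n]`**: for `φ ∈ X₄(F)` and `σ ∈ S₄`, the spectral point `φ^σ` of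
`EdgePencilLegSymmetry.exists_spectrum_legPerm` takes the same value as `φ` on `T(K₄)_n`, for every `n`;
in particular `φ^σ` is `T(K₄)`-maximal iff `φ` is. [cite: Strassen1988, §2] -/
theorem exists_spectrum_legPerm_tetra (σ : Equiv.Perm (Fin 4)) {φ : DTensorClass F 4 → ℝ}
    (hφ : φ ∈ DTensorClass.asymptoticSpectrumDTensors F 2) :
    ∃ φ' ∈ DTensorClass.asymptoticSpectrumDTensors F 2,
      (∀ (n : ℕ) (t : (Fin 4 → Fin n) → F),
        φ' (DTensorClass.mk t) = φ (DTensorClass.mk (fun i : Fin 4 → Fin n => t (fun j => i (σ j))))) ∧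
      ∀ n : ℕ, φ' (DTensorClass.mk (tetra F n)) = φ (DTensorClass.mk (tetra F n)) := by
  obtain ⟨φ', hφ', h⟩ := exists_spectrum_legPerm F σ hφ
  exact ⟨φ', hφ', h, fun n => by rw [h]; exact apply_mk_tetra_legPerm φ n σ⟩

/-- **The six EPR pairs of `K₄` are ONE orbit**: the pair on parties `σ 0, σ 1` is the leg-permuted pair on
parties `0, 1` (definitional), so `φ[P^{σ0 σ1}_e] = φ^σ[P^{01}_e]`. [cite: ChristandlVranaZuiddam2016, Ex. 1.1.2] -/
theorem pair_legPerm (σ : Equiv.Perm (Fin 4)) (e : ℕ) :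
    (fun i : Fin 4 → Fin e => (fun a : Fin 4 → Fin e => (ind (a 0 = a 1) : F)) (fun j => i (σ j))) =
      fun a : Fin 4 → Fin e => (ind (a (σ 0) = a (σ 1)) : F) :=
  rfl

end SpectrumTetra

end Summit.MatrixMultiplication.MatrixMultiplication.Theorems.EdgePencil

end
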